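import Literature.IUT.HodgeTheaters.TemperedCoveringsCor23OfSpecialFibreDecomp
import Literature.IUT.HodgeTheaters.TemperedCoveringsCor23OfSpecialFibreCommTerminal
import Literature.AnabelianGeometry.SemiGraphs.TemperedSubgraphThm37Hypotheses
import HarnessLib

/-!
# [IUTchI] Cor. 2.3 (i), (iv), (v) at the GENUINE 𝔛-datum for a GENERAL connected sub-semi-graph `ℍ` with a vertex:
# every `𝒢_ℍ`-side law DISCHARGED (row «DECOMP-L5-MERGE» (B) = «COR23-GENERAL-H-CONSUME»)

Mochizuki, *Inter-universal Teichmüller theory I: construction of Hodge theaters*, kurims manuscript (May 2020), §2: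
p. 44 l. 27–29 ("the semi-graph of anabelioids associated to a connected sub-semi-graph `ℍ ⊆ 𝔾`"), p. 47 l. 22–24
("suppose … that the sub-semi-graph `ℍ ⊆ 𝔾` is stabilized by the natural action of `G_k` on `𝔾`"), Corollary 2.3
(i) p. 47, (iv) p. 47, (v) p. 48 l. 1–2; proof p. 48 l. 13 ("Assertion (i) follows immediately from Proposition 2.2"),
p. 49 l. 33–34 ((iv) from (i) and (iii)), p. 49 l. 38 – p. 50 l. 2 ((v)) [cite: Mochizuki2012, Cor 2.3 pp.47-50]
(D-0012 claim key; series status DISPUTED; nothing of the series is asserted here — the [IUTchI] items are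
`[claim: Mochizuki2012, status: disputed]`, PROVED are the displayed statements about the tree's own objects);
Mochizuki, *Semi-graphs of anabelioids*, Publ. RIMS **42** (2006), Def. 2.3 (iii) p. 25 (coherent), Ex. 2.10 p. 31,
Prop. 2.5 (i) p. 27, Thm. 3.7 pp. 40–41, Cor. 2.7 (i) p. 30 [cite: MochizukiSemiAnbd2006, Thm 3.7 pp.40-41].

PROOF-ONLY sequel (abc-iut cell; seat abc-iut-w4-d052 gen 6; L5-lead RULINGS #101 (2) GO; spec = the L5 lead's
row «COR23-GENERAL-H-CONSUME») of abc-iut-w4-d052's junction `TemperedCoveringsCor23OfSpecialFibreDecomp.lean`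
(p473441: rows (i)/(v) at general `ℍ` for `Π^tp_ℍ := TpH ∈ S.chart.decompSubgroups ℍ` MODULO `hind`/(DOM), `h37H`,
`hhat`, `hCIV`) composed BY NAME with the L3 closers: the capstone `IsDecompHom.isInducing` (p476935), abc-iut-w5-d240's
(P3) `isCommensurablyTerminal_topologicalClosure_map_of_mem_decompSubgroups` (p466047) and (P1)
`comap_topologicalClosure_map_eq_of_mem_decompSubgroups_of_isInducing` (p471440), and abc-iut-w4-d052's
`TemperedSubgraphThm37Hypotheses.lean` (`Thm37Hypotheses.restrictSub`, the p. 44 atoms `hq`/`hel` from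
`Prop36Hypotheses`, `…_of_isConnected` / `…_of_prop36` / `…_of_isCoherent` corollaries).  Headlines, for GENERAL finite
connected `ℍ` with a vertex and EVERY `TpH ∈ S.chart.decompSubgroups ℍ`, print's `Π̂_ℍ :=` the closure of `ι(Π^tp_ℍ)`:

* (i) `cor23i_ofSpecialFibre_closureH_of_mem_decompSubgroups (hTpH) (hconn) (hv)` — NO law binder;
* (v) `cor23v_ofSpecialFibre_closureH_of_mem_decompSubgroups (hcoh) (hTpH) (hconn) (hv)` — one binder `hcoh`
  (COHERENCE of `G^c`); the closed-edge hypothesis of the L3 (P1) theorem is discharged by a case split (a closed edge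
  of `ℍ` is a closed edge of `𝔾`, `Subgraph.isClosedEdge_of_isClosedEdge_toSemiGraph`; if `ℍ` has none, `Π^tp_ℍ` is
  compact, `TemperedPiChart.compactSpace_of_forall_not_isClosedEdge`, and abc-iut-w5-d028's
  `cor23v_ofSpecialFibre_closureH_of_isCompact` applies);
* (iv) `cor23iv_ofSpecialFibre_closureH_of_mem_decompSubgroups (P) (hA) (hB) (hTpH) (hconn) (hv) (hHstab)` and the
  blocks `cor23_i_to_iv_…` / `cor23_i_to_v_ofSpecialFibre_closureH_of_piData_of_mem_decompSubgroups` over abc-iut-L3's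
  `SpecialFibreTower.PiData` record — abc-iut-w5-d028's `…_of_commTerminal` closers with `htp`, `hhat` DISCHARGED.

## BINDER CENSUS TABLE (L5-lead RULINGS #101 (2); one line per remaining binder; classes DATA · DATUM-INTERNAL ·
## FACT-INSTANCE · LAW)

| binder | in | class | what it is in print |
|---|---|---|---|
| `X`, `d`, `S`, `Σ`/`Σ̂`, `hsub`, `hne`, `hprime`, `hp`, `cuspMeetsH` | all | DATA | the curve, its group-level data, the special-fibre datum `𝔛` ([SemiAnbd] Ex. 3.10), the prime sets with print's side conditions (p. 47 l. 21: `p ∉ Σ`), the cusp predicate of (vi) |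
| `h36 : S.Gc.Prop36Hypotheses` | all | DATUM-INTERNAL | = `S.hyp.toProp36Hypotheses` up to proof irrelevance (kept as the section variable of the genuine-datum files; it only NAMES the completion `ι`) |
| `S.hyp : S.Gc.Thm37Hypotheses` | all (implicit) | DATUM-INTERNAL | field of `SpecialFibreData` ("`G^c` satisfies the hypotheses of Thm. 3.7", Ex. 3.10 p. 44) |
| `TpH`, `hTpH : TpH ∈ S.chart.decompSubgroups ℍ` | all | DATA | print's parameter `Π^tp_ℍ`, a decomposition group of `ℍ` (p. 44 l. 39–44), the genuine carrier of GAP row G-w5d028-2 |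
| `hconn : (S.Gc.restrict ℍ).IsConnected`, `hv : (S.Gc.restrict ℍ).HasVertex` | all | DATA | print's standing shape of `ℍ`: "a connected sub-semi-graph" (p. 44 l. 28) whose maximal subgraph is of PSC-type (p. 44 l. 29–32; hence has a vertex) |
| `[Finite ℍ.toSemiGraph.Vertex]`, `[Finite ℍ.toSemiGraph.Edge]` | (i), (iv) | DATA | `ℍ ⊆` the FINITE dual semi-graph of the special fibre (finiteness is not a field of `SpecialFibreData`; for finite `G^c` they are `Subtype.finite`, see `…_of_finite_Gc`) |
| `[Finite S.Gc.graph.Vertex]`, `[Finite S.Gc.graph.Edge]` | (v), (i)–(v) | DATA | the dual semi-graph of the geometric special fibre of the stable model is finite ([SemiAnbd] Ex. 3.10 p. 44) |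
| `hcoh : S.Gc.IsCoherent` | (v), (i)–(v) | FACT-INSTANCE | [SemiAnbd] Def. 2.3 (iii) p. 25 "coherent" AT `G^c`: the instance of [SemiAnbd] Example 2.10 (p. 31, "the semi-graph of anabelioids … of a stable log curve … is coherent") for this curve; `SpecialFibreData` records only the Thm. 3.7 bundle (quasi-coherence), not the finite generation of the `Π_v`, `Π_e` that M. Hall separability ((P1), p. 49 l. 38 – p. 50 l. 2) uses |
| `T`, `P : SpecialFibreTower.PiData X d S T` | (iv), blocks | DATA | abc-iut-L3's characteristic-tower / arithmetic-action record at the datum (as in every `…_of_piData…` closer) |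
| `hA`, `hB` | (iv), blocks | LAW | the centraliser laws feeding Cor. 2.3 (iii) under its hypotheses (a) `∃ l ∈ Σ̂ ∖ (Σ ∪ {p})` / (b) `Σ̂ = Primes` (p. 47), exactly as in abc-iut-w5-d028's one-vertex census `{hhat, hA, hB}`; `hB` is idle for finite `Σ̂` (`…_of_finite` closers of the CommTerminal file) |
| `hHstab` | (iv), blocks | LAW | typed shadow, at the group level ("the `Π^tp_X`-conjugation class of `Π^tp_ℍ` is stable"), of print's HYPOTHESIS "`ℍ` is stabilized by the natural action of `G_k` on `𝔾`" (p. 47 l. 22–24); the dictionary «`ℍ` `G_k`-stable ⇒ `hHstab` for `TpH ∈ decompSubgroups ℍ`» is SUBDAG-IUTchI-Cor23 (P4) (open, L3) — at `ℍ = {v}` it is abc-iut-w5-d028's `hHstab_of_piData_of_H_verts_eq_singleton` |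

GONE (theorems by name): `hind`/(DOM) (capstone p476935), `h37H` (`Thm37Hypotheses.restrictSub`), `hhat`
(`isCommensurablyTerminal_topologicalClosure_map_of_mem_decompSubgroups_of_prop36`), `htp`
(`decompSubgroupsCommensurablyTerminal_of_isConnected_of_finite`), `hCIV` (`compactInVerticialFin_holds`), `hcl` (case
split), `h36'`/`hcoh'`/`hq`/`hel` (restriction lemmas).  COUNTS: (i) laws 0 · (v) laws 0, FACT-INSTANCE 1 (`hcoh`) · (iv)
laws 3 (`hA`, `hB`, `hHstab`; finite `Σ̂`: `hB` idle).  Model-RELATIVE (the genuine datum `ofSpecialFibre`); typed ≠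
discharged for the [IUTchI] claim keys; no definition, no instance, no new `Prop` fact; nothing here bears on [IUTchIII]
Cor. 3.12 or asserts that abc is proved or refuted.
-/

noncomputable section

namespace Literature.IUT.HodgeTheaters

open _root_.Topology
open scoped Pointwise
open Literature.AnabelianGeometry.SemiGraphs
open Literature.AnabelianGeometry.SemiGraphs.ProfiniteSemiGraph (TemperedPiChart CompactInVerticialAt
  compactInVerticialFin_holds)
open Literature.AnabelianGeometry.SemiGraphs.ProfiniteSemiGraph.TemperedPiChart
  (decompSubgroupsCommensurablyTerminal_of_isConnected_of_finite
   isCommensurablyTerminal_topologicalClosure_map_of_mem_decompSubgroups_of_prop36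
   comap_topologicalClosure_map_eq_of_mem_decompSubgroups_of_isCoherent IsDecompHom.isInducing_of_isConnected)
open Literature.AnabelianGeometry.AbsoluteAnabelian (IsCommensurablyTerminal)

namespace StableCurveTemperedData

section Rows

variable {p : ℕ} [Fact p.Prime] (X : TemperedCurve p) (d : X.GroupLevelData)
  (S : SpecialFibreData (X.toTemperedArithmeticGroup d)) (h36 : S.Gc.Prop36Hypotheses)
  (Sigma SigmaHat : Set ℕ) (hsub : Sigma ⊆ SigmaHat) (hne : Sigma.Nonempty)
  (hprime : ∀ q ∈ SigmaHat, q.Prime) (hp : p ∉ Sigma)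
  (TpH : Subgroup S.chart.G)
  (cuspMeetsH : {x : X.Pt // X.IsCusp x} → Prop)

/-! ### A. Cor. 2.3 (i) at general `ℍ`: no law binder -/

/-- **Row `IUTchI:Cor2.3(i)` at the genuine datum for EVERY `Π^tp_ℍ := TpH ∈ decompSubgroups S.chart ℍ`, GENERAL finite
connected `ℍ` with a vertex — NO law binder**: abc-iut-w4-d052's `…_of_isInducing` junction (p473441) with `h37H :=
S.hyp.restrictSub`, `hCIV := compactInVerticialFin_holds`, one decomposition homomorphism from `decompHomExists` (its chart
from Prop. 3.6, `temperedPiChart`), `hind :=` the capstone, and `hhat :=` the (P3) theorem with its p. 44 atoms derived.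
Remaining binders: DATA only (census table in the module docstring). [cite: Mochizuki2012, Cor 2.3(i) pp.47-48] -/
theorem cor23i_ofSpecialFibre_closureH_of_mem_decompSubgroups {H : S.Gc.graph.Subgraph}
    [Finite H.toSemiGraph.Vertex] [Finite H.toSemiGraph.Edge] (hTpH : TpH ∈ S.chart.decompSubgroups H)
    (hconn : (S.Gc.restrict H).IsConnected) (hv : (S.Gc.restrict H).HasVertex) :
    (ofSpecialFibre X d S h36 Sigma SigmaHat hsub hne hprime hp TpH
      ((TpH.map (TemperedGraphGroupData.exists_completion_of_prop36 S.Gc h36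
        S.chart).choose_spec.choose.toMonoidHom).topologicalClosure) (Subgroup.le_topologicalClosure _) cuspMeetsH).Cor23i := by
  obtain ⟨φ, hφ⟩ := S.chart.decompHomExists H
    ((S.Gc.restrict H).temperedPiChart (h36.restrictSub H hconn hv))
  exact cor23i_ofSpecialFibre_closureH_of_mem_decompSubgroups_of_isInducing_of_finite X d S h36 Sigma SigmaHat hsub
    hne hprime hp TpH cuspMeetsH hTpH (S.hyp.restrictSub H hconn hv) hφ
    (hφ.isInducing_of_isConnected S.hyp hconn hv)
    (isCommensurablyTerminal_topologicalClosure_map_of_mem_decompSubgroups_of_prop36 h36 hconn hv S.chart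
      (TemperedGraphGroupData.exists_completion_of_prop36 S.Gc h36 S.chart).choose_spec.choose_spec.1 hTpH)

/-- **The same with `ℍ`'s finiteness DERIVED from that of the dual semi-graph `G^c`** (`Subtype.finite`).
[cite: Mochizuki2012, Cor 2.3(i) pp.47-48] -/
theorem cor23i_ofSpecialFibre_closureH_of_mem_decompSubgroups_of_finite_Gc {H : S.Gc.graph.Subgraph}
    [Finite S.Gc.graph.Vertex] [Finite S.Gc.graph.Edge] (hTpH : TpH ∈ S.chart.decompSubgroups H)
    (hconn : (S.Gc.restrict H).IsConnected) (hv : (S.Gc.restrict H).HasVertex) :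
    (ofSpecialFibre X d S h36 Sigma SigmaHat hsub hne hprime hp TpH
      ((TpH.map (TemperedGraphGroupData.exists_completion_of_prop36 S.Gc h36
        S.chart).choose_spec.choose.toMonoidHom).topologicalClosure) (Subgroup.le_topologicalClosure _) cuspMeetsH).Cor23i :=
  haveI : Finite H.toSemiGraph.Vertex := inferInstanceAs (Finite H.verts)
  haveI : Finite H.toSemiGraph.Edge := inferInstanceAs (Finite H.edges)
  cor23i_ofSpecialFibre_closureH_of_mem_decompSubgroups X d S h36 Sigma SigmaHat hsub hne hprime hp TpH cuspMeetsH
    hTpH hconn hv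

/-! ### B. Cor. 2.3 (v) at general `ℍ`: one FACT-INSTANCE binder (coherence of `G^c`) -/

/-- **Row `IUTchI:Cor2.3(v)` at the genuine datum for EVERY `Π^tp_ℍ := TpH ∈ decompSubgroups S.chart ℍ`, GENERAL connected
`ℍ` with a vertex in the FINITE dual semi-graph `G^c`, binder `hcoh : S.Gc.IsCoherent` only**: `Δ̂_{X,ℍ} ∩ Δ^tp_X =
Δ^tp_{X,ℍ}`.  If `ℍ` has a closed edge, it is a closed edge of `𝔾` (`Subgraph.isClosedEdge_of_isClosedEdge_toSemiGraph`)
and the (P1) theorem in the derived-binder form `comap_topologicalClosure_map_eq_of_mem_decompSubgroups_of_isCoherent`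
gives `ι⁻¹(Π̂_ℍ) = Π^tp_ℍ` (`cor23v_iff_comap`); if `ℍ` has NO closed edge, `π₁^temp(G^c|_ℍ)` is compact
(`TemperedPiChart.compactSpace_of_forall_not_isClosedEdge`), so `Π^tp_ℍ = range φ` is compact and abc-iut-w5-d028's
`cor23v_ofSpecialFibre_closureH_of_isCompact` applies. [cite: Mochizuki2012, Cor 2.3(v) pp.48-50] -/
theorem cor23v_ofSpecialFibre_closureH_of_mem_decompSubgroups {H : S.Gc.graph.Subgraph}
    [Finite S.Gc.graph.Vertex] [Finite S.Gc.graph.Edge] (hcoh : S.Gc.IsCoherent)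
    (hTpH : TpH ∈ S.chart.decompSubgroups H) (hconn : (S.Gc.restrict H).IsConnected)
    (hv : (S.Gc.restrict H).HasVertex) :
    (ofSpecialFibre X d S h36 Sigma SigmaHat hsub hne hprime hp TpH
      ((TpH.map (TemperedGraphGroupData.exists_completion_of_prop36 S.Gc h36
        S.chart).choose_spec.choose.toMonoidHom).topologicalClosure) (Subgroup.le_topologicalClosure _) cuspMeetsH).Cor23v := by
  haveI : Finite (S.Gc.restrict H).graph.Vertex := inferInstanceAs (Finite H.verts)
  haveI : Finite (S.Gc.restrict H).graph.Edge := inferInstanceAs (Finite H.edges)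
  by_cases hcl' : ∃ e : (S.Gc.restrict H).graph.Edge, (S.Gc.restrict H).graph.IsClosedEdge e
  · -- a closed edge of `ℍ` is a closed edge of `𝔾`: the (P1) route
    obtain ⟨e, he⟩ := hcl'
    have hcl : ∃ e : S.Gc.graph.Edge, S.Gc.graph.IsClosedEdge e :=
      ⟨e.1, H.isClosedEdge_of_isClosedEdge_toSemiGraph e.2 he⟩
    exact (ofSpecialFibre X d S h36 Sigma SigmaHat hsub hne hprime hp TpH
      ((TpH.map (TemperedGraphGroupData.exists_completion_of_prop36 S.Gc h36
        S.chart).choose_spec.choose.toMonoidHom).topologicalClosure) (Subgroup.le_topologicalClosure _)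
        cuspMeetsH).cor23v_iff_comap.2
      (comap_topologicalClosure_map_eq_of_mem_decompSubgroups_of_isCoherent S.hyp hcoh hcl hconn hv S.chart
        (TemperedGraphGroupData.exists_completion_of_prop36 S.Gc h36 S.chart).choose_spec.choose_spec.1 hTpH)
  · -- no closed edge in `ℍ`: `Π^tp_ℍ` is compact
    obtain ⟨c', φ, -, hD⟩ := hTpH
    haveI : CompactSpace c'.G :=
      c'.compactSpace_of_forall_not_isClosedEdge (h36.restrictSub H hconn hv) (not_exists.mp hcl')
    have hc : IsCompact (TpH : Set S.chart.G) := by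
      rw [hD, MonoidHom.coe_range]
      exact isCompact_range φ.continuous
    exact cor23v_ofSpecialFibre_closureH_of_isCompact X d S h36 Sigma SigmaHat hsub hne hprime hp TpH cuspMeetsH hc

end Rows

/-! ### C. Cor. 2.3 (iv) and the blocks (i)–(iv), (i)–(v) over L3's `SpecialFibreTower.PiData` at general `ℍ` -/

section Block

variable {p : ℕ} [Fact p.Prime] (X : TemperedCurve p) (d : X.GroupLevelData)
  (S : SpecialFibreData (X.toTemperedArithmeticGroup d)) (h36 : S.Gc.Prop36Hypotheses)
  (Sigma SigmaHat : Set ℕ) (hsub : Sigma ⊆ SigmaHat) (hne : Sigma.Nonempty)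
  (hprime : ∀ q ∈ SigmaHat, q.Prime) (hp : p ∉ Sigma)
  (TpH : Subgroup S.chart.G)
  (cuspMeetsH : {x : X.Pt // X.IsCusp x} → Prop)
  (T : SpecialFibreTower X.DeltaTemp)

/-- **[IUTchI] Cor. 2.3 (i)–(iv) AS TYPED at the genuine datum, print's `Π̂_ℍ`, `Π^tp_ℍ := TpH ∈ decompSubgroups S.chart ℍ`,
GENERAL finite connected `ℍ` with a vertex, over the `PiData` record**: abc-iut-w5-d028's
`cor23_i_to_iv_ofSpecialFibre_closureH_of_piData_of_commTerminal` with `htp :=` [IUTchI] Prop. 2.2 third inclusion for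
general `ℍ` (`decompSubgroupsCommensurablyTerminal_of_isConnected_of_finite`) and `hhat :=` the (P3) theorem; binder list
`{hHstab, hA, hB}` (census table). [cite: Mochizuki2012, Cor 2.3 pp.47-49] -/
theorem cor23_i_to_iv_ofSpecialFibre_closureH_of_piData_of_mem_decompSubgroups (P : SpecialFibreTower.PiData X d S T)
    (hA : (∃ l ∈ SigmaHat, l ∉ Sigma ∧ l ≠ p) →
      ∀ (i : ℕ) (a : (ofSpecialFibre X d S h36 Sigma SigmaHat hsub hne hprime hp TpH
      ((TpH.map (TemperedGraphGroupData.exists_completion_of_prop36 S.Gc h36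
        S.chart).choose_spec.choose.toMonoidHom).topologicalClosure) (Subgroup.le_topologicalClosure _) cuspMeetsH).DeltaHat),
        (∀ x ∈ ((OfSpecialFibre.towerOfSpecialFibreTower X d T Sigma SigmaHat hsub hne hprime S h36 hp TpH
        ((TpH.map (TemperedGraphGroupData.exists_completion_of_prop36 S.Gc h36
        S.chart).choose_spec.choose.toMonoidHom).topologicalClosure) (Subgroup.le_topologicalClosure _)
        cuspMeetsH).Jhat i).subgroupOf (ofSpecialFibre X d S h36 Sigma SigmaHat hsub hne hprime hp TpH
      ((TpH.map (TemperedGraphGroupData.exists_completion_of_prop36 S.Gc h36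
        S.chart).choose_spec.choose.toMonoidHom).topologicalClosure) (Subgroup.le_topologicalClosure _) cuspMeetsH).DeltaHat,
          x ∈ (ofSpecialFibre X d S h36 Sigma SigmaHat hsub hne hprime hp TpH
      ((TpH.map (TemperedGraphGroupData.exists_completion_of_prop36 S.Gc h36
        S.chart).choose_spec.choose.toMonoidHom).topologicalClosure) (Subgroup.le_topologicalClosure _) cuspMeetsH).ρHat.ker → a * x = x * a) →
        a ∈ ((OfSpecialFibre.towerOfSpecialFibreTower X d T Sigma SigmaHat hsub hne hprime S h36 hp TpH
        ((TpH.map (TemperedGraphGroupData.exists_completion_of_prop36 S.Gc h36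
        S.chart).choose_spec.choose.toMonoidHom).topologicalClosure) (Subgroup.le_topologicalClosure _)
        cuspMeetsH).Jhat i).subgroupOf (ofSpecialFibre X d S h36 Sigma SigmaHat hsub hne hprime hp TpH
      ((TpH.map (TemperedGraphGroupData.exists_completion_of_prop36 S.Gc h36
        S.chart).choose_spec.choose.toMonoidHom).topologicalClosure) (Subgroup.le_topologicalClosure _) cuspMeetsH).DeltaHat)
    (hB : SigmaHat = {q | q.Prime} →
      ∀ (i : ℕ) (a : (ofSpecialFibre X d S h36 Sigma SigmaHat hsub hne hprime hp TpH
      ((TpH.map (TemperedGraphGroupData.exists_completion_of_prop36 S.Gc h36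
        S.chart).choose_spec.choose.toMonoidHom).topologicalClosure) (Subgroup.le_topologicalClosure _) cuspMeetsH).DeltaHat),
        (∀ x ∈ ((OfSpecialFibre.towerOfSpecialFibreTower X d T Sigma SigmaHat hsub hne hprime S h36 hp TpH
        ((TpH.map (TemperedGraphGroupData.exists_completion_of_prop36 S.Gc h36
        S.chart).choose_spec.choose.toMonoidHom).topologicalClosure) (Subgroup.le_topologicalClosure _)
        cuspMeetsH).Jhat i).subgroupOf (ofSpecialFibre X d S h36 Sigma SigmaHat hsub hne hprime hp TpH
      ((TpH.map (TemperedGraphGroupData.exists_completion_of_prop36 S.Gc h36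
        S.chart).choose_spec.choose.toMonoidHom).topologicalClosure) (Subgroup.le_topologicalClosure _) cuspMeetsH).DeltaHat,
          x ∈ (ofSpecialFibre X d S h36 Sigma SigmaHat hsub hne hprime hp TpH
      ((TpH.map (TemperedGraphGroupData.exists_completion_of_prop36 S.Gc h36
        S.chart).choose_spec.choose.toMonoidHom).topologicalClosure) (Subgroup.le_topologicalClosure _) cuspMeetsH).ρHat.ker → a * x = x * a) →
        a ∈ ((OfSpecialFibre.towerOfSpecialFibreTower X d T Sigma SigmaHat hsub hne hprime S h36 hp TpH
        ((TpH.map (TemperedGraphGroupData.exists_completion_of_prop36 S.Gc h36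
        S.chart).choose_spec.choose.toMonoidHom).topologicalClosure) (Subgroup.le_topologicalClosure _)
        cuspMeetsH).Jhat i).subgroupOf (ofSpecialFibre X d S h36 Sigma SigmaHat hsub hne hprime hp TpH
      ((TpH.map (TemperedGraphGroupData.exists_completion_of_prop36 S.Gc h36
        S.chart).choose_spec.choose.toMonoidHom).topologicalClosure) (Subgroup.le_topologicalClosure _) cuspMeetsH).DeltaHat)
    {H : S.Gc.graph.Subgraph} [Finite H.toSemiGraph.Vertex] [Finite H.toSemiGraph.Edge]
    (hTpH : TpH ∈ S.chart.decompSubgroups H) (hconn : (S.Gc.restrict H).IsConnected)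
    (hv : (S.Gc.restrict H).HasVertex)
    (hHstab : ∀ g : X.PiTemp, ∃ t : S.chart.G,
      TpH.map (S.autOfConj P.admissibleKer_normal_pi g).toMulEquiv.toMonoidHom = MulAut.conj t • TpH) :
    (ofSpecialFibre X d S h36 Sigma SigmaHat hsub hne hprime hp TpH
      ((TpH.map (TemperedGraphGroupData.exists_completion_of_prop36 S.Gc h36
        S.chart).choose_spec.choose.toMonoidHom).topologicalClosure) (Subgroup.le_topologicalClosure _) cuspMeetsH).Cor23i ∧
      (ofSpecialFibre X d S h36 Sigma SigmaHat hsub hne hprime hp TpH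
      ((TpH.map (TemperedGraphGroupData.exists_completion_of_prop36 S.Gc h36
        S.chart).choose_spec.choose.toMonoidHom).topologicalClosure) (Subgroup.le_topologicalClosure _) cuspMeetsH).Cor23ii ∧
      (ofSpecialFibre X d S h36 Sigma SigmaHat hsub hne hprime hp TpH
      ((TpH.map (TemperedGraphGroupData.exists_completion_of_prop36 S.Gc h36
        S.chart).choose_spec.choose.toMonoidHom).topologicalClosure) (Subgroup.le_topologicalClosure _) cuspMeetsH).Cor23iii ∧
      (ofSpecialFibre X d S h36 Sigma SigmaHat hsub hne hprime hp TpH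
      ((TpH.map (TemperedGraphGroupData.exists_completion_of_prop36 S.Gc h36
        S.chart).choose_spec.choose.toMonoidHom).topologicalClosure) (Subgroup.le_topologicalClosure _) cuspMeetsH).Cor23iv :=
  cor23_i_to_iv_ofSpecialFibre_closureH_of_piData_of_commTerminal X d S h36 Sigma SigmaHat hsub hne hprime hp TpH
    cuspMeetsH T P hA hB (decompSubgroupsCommensurablyTerminal_of_isConnected_of_finite S.hyp hconn hv TpH hTpH)
    (isCommensurablyTerminal_topologicalClosure_map_of_mem_decompSubgroups_of_prop36 h36 hconn hv S.chart
      (TemperedGraphGroupData.exists_completion_of_prop36 S.Gc h36 S.chart).choose_spec.choose_spec.1 hTpH) hHstab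

/-- **Row `IUTchI:Cor2.3(iv)` at the genuine datum for EVERY `Π^tp_ℍ := TpH ∈ decompSubgroups S.chart ℍ`, GENERAL finite
connected `ℍ` with a vertex** ("in light of the exact sequences of assertion (iii), assertion (iv) follows immediately from
assertion (i)", p. 49 l. 33–34): binder list `{hHstab, hA, hB}`. [cite: Mochizuki2012, Cor 2.3(iv) p.49] -/
theorem cor23iv_ofSpecialFibre_closureH_of_mem_decompSubgroups (P : SpecialFibreTower.PiData X d S T)
    (hA : (∃ l ∈ SigmaHat, l ∉ Sigma ∧ l ≠ p) →
      ∀ (i : ℕ) (a : (ofSpecialFibre X d S h36 Sigma SigmaHat hsub hne hprime hp TpH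
      ((TpH.map (TemperedGraphGroupData.exists_completion_of_prop36 S.Gc h36
        S.chart).choose_spec.choose.toMonoidHom).topologicalClosure) (Subgroup.le_topologicalClosure _) cuspMeetsH).DeltaHat),
        (∀ x ∈ ((OfSpecialFibre.towerOfSpecialFibreTower X d T Sigma SigmaHat hsub hne hprime S h36 hp TpH
        ((TpH.map (TemperedGraphGroupData.exists_completion_of_prop36 S.Gc h36
        S.chart).choose_spec.choose.toMonoidHom).topologicalClosure) (Subgroup.le_topologicalClosure _)
        cuspMeetsH).Jhat i).subgroupOf (ofSpecialFibre X d S h36 Sigma SigmaHat hsub hne hprime hp TpH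
      ((TpH.map (TemperedGraphGroupData.exists_completion_of_prop36 S.Gc h36
        S.chart).choose_spec.choose.toMonoidHom).topologicalClosure) (Subgroup.le_topologicalClosure _) cuspMeetsH).DeltaHat,
          x ∈ (ofSpecialFibre X d S h36 Sigma SigmaHat hsub hne hprime hp TpH
      ((TpH.map (TemperedGraphGroupData.exists_completion_of_prop36 S.Gc h36
        S.chart).choose_spec.choose.toMonoidHom).topologicalClosure) (Subgroup.le_topologicalClosure _) cuspMeetsH).ρHat.ker → a * x = x * a) →
        a ∈ ((OfSpecialFibre.towerOfSpecialFibreTower X d T Sigma SigmaHat hsub hne hprime S h36 hp TpH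
        ((TpH.map (TemperedGraphGroupData.exists_completion_of_prop36 S.Gc h36
        S.chart).choose_spec.choose.toMonoidHom).topologicalClosure) (Subgroup.le_topologicalClosure _)
        cuspMeetsH).Jhat i).subgroupOf (ofSpecialFibre X d S h36 Sigma SigmaHat hsub hne hprime hp TpH
      ((TpH.map (TemperedGraphGroupData.exists_completion_of_prop36 S.Gc h36
        S.chart).choose_spec.choose.toMonoidHom).topologicalClosure) (Subgroup.le_topologicalClosure _) cuspMeetsH).DeltaHat)
    (hB : SigmaHat = {q | q.Prime} →
      ∀ (i : ℕ) (a : (ofSpecialFibre X d S h36 Sigma SigmaHat hsub hne hprime hp TpH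
      ((TpH.map (TemperedGraphGroupData.exists_completion_of_prop36 S.Gc h36
        S.chart).choose_spec.choose.toMonoidHom).topologicalClosure) (Subgroup.le_topologicalClosure _) cuspMeetsH).DeltaHat),
        (∀ x ∈ ((OfSpecialFibre.towerOfSpecialFibreTower X d T Sigma SigmaHat hsub hne hprime S h36 hp TpH
        ((TpH.map (TemperedGraphGroupData.exists_completion_of_prop36 S.Gc h36
        S.chart).choose_spec.choose.toMonoidHom).topologicalClosure) (Subgroup.le_topologicalClosure _)
        cuspMeetsH).Jhat i).subgroupOf (ofSpecialFibre X d S h36 Sigma SigmaHat hsub hne hprime hp TpH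
      ((TpH.map (TemperedGraphGroupData.exists_completion_of_prop36 S.Gc h36
        S.chart).choose_spec.choose.toMonoidHom).topologicalClosure) (Subgroup.le_topologicalClosure _) cuspMeetsH).DeltaHat,
          x ∈ (ofSpecialFibre X d S h36 Sigma SigmaHat hsub hne hprime hp TpH
      ((TpH.map (TemperedGraphGroupData.exists_completion_of_prop36 S.Gc h36
        S.chart).choose_spec.choose.toMonoidHom).topologicalClosure) (Subgroup.le_topologicalClosure _) cuspMeetsH).ρHat.ker → a * x = x * a) →
        a ∈ ((OfSpecialFibre.towerOfSpecialFibreTower X d T Sigma SigmaHat hsub hne hprime S h36 hp TpH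
        ((TpH.map (TemperedGraphGroupData.exists_completion_of_prop36 S.Gc h36
        S.chart).choose_spec.choose.toMonoidHom).topologicalClosure) (Subgroup.le_topologicalClosure _)
        cuspMeetsH).Jhat i).subgroupOf (ofSpecialFibre X d S h36 Sigma SigmaHat hsub hne hprime hp TpH
      ((TpH.map (TemperedGraphGroupData.exists_completion_of_prop36 S.Gc h36
        S.chart).choose_spec.choose.toMonoidHom).topologicalClosure) (Subgroup.le_topologicalClosure _) cuspMeetsH).DeltaHat)
    {H : S.Gc.graph.Subgraph} [Finite H.toSemiGraph.Vertex] [Finite H.toSemiGraph.Edge]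
    (hTpH : TpH ∈ S.chart.decompSubgroups H) (hconn : (S.Gc.restrict H).IsConnected)
    (hv : (S.Gc.restrict H).HasVertex)
    (hHstab : ∀ g : X.PiTemp, ∃ t : S.chart.G,
      TpH.map (S.autOfConj P.admissibleKer_normal_pi g).toMulEquiv.toMonoidHom = MulAut.conj t • TpH) :
    (ofSpecialFibre X d S h36 Sigma SigmaHat hsub hne hprime hp TpH
      ((TpH.map (TemperedGraphGroupData.exists_completion_of_prop36 S.Gc h36
        S.chart).choose_spec.choose.toMonoidHom).topologicalClosure) (Subgroup.le_topologicalClosure _) cuspMeetsH).Cor23iv :=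
  (cor23_i_to_iv_ofSpecialFibre_closureH_of_piData_of_mem_decompSubgroups X d S h36 Sigma SigmaHat hsub hne hprime hp TpH
    cuspMeetsH T P hA hB hTpH hconn hv hHstab).2.2.2

/-- **Rows (i)–(v) together at general `ℍ` in the FINITE dual semi-graph**: the block above AND Cor. 2.3 (v); binder list
`{hHstab, hA, hB}` + the FACT-INSTANCE `hcoh` (coherence of `G^c`, [SemiAnbd] Ex. 2.10) — vs. abc-iut-w5-d028's one-vertex
`{hhat, hHstab, hA, hB}`: `hhat` is now a theorem. [cite: Mochizuki2012, Cor 2.3 pp.47-50] -/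
theorem cor23_i_to_v_ofSpecialFibre_closureH_of_piData_of_mem_decompSubgroups (P : SpecialFibreTower.PiData X d S T)
    (hA : (∃ l ∈ SigmaHat, l ∉ Sigma ∧ l ≠ p) →
      ∀ (i : ℕ) (a : (ofSpecialFibre X d S h36 Sigma SigmaHat hsub hne hprime hp TpH
      ((TpH.map (TemperedGraphGroupData.exists_completion_of_prop36 S.Gc h36
        S.chart).choose_spec.choose.toMonoidHom).topologicalClosure) (Subgroup.le_topologicalClosure _) cuspMeetsH).DeltaHat),
        (∀ x ∈ ((OfSpecialFibre.towerOfSpecialFibreTower X d T Sigma SigmaHat hsub hne hprime S h36 hp TpH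
        ((TpH.map (TemperedGraphGroupData.exists_completion_of_prop36 S.Gc h36
        S.chart).choose_spec.choose.toMonoidHom).topologicalClosure) (Subgroup.le_topologicalClosure _)
        cuspMeetsH).Jhat i).subgroupOf (ofSpecialFibre X d S h36 Sigma SigmaHat hsub hne hprime hp TpH
      ((TpH.map (TemperedGraphGroupData.exists_completion_of_prop36 S.Gc h36
        S.chart).choose_spec.choose.toMonoidHom).topologicalClosure) (Subgroup.le_topologicalClosure _) cuspMeetsH).DeltaHat,
          x ∈ (ofSpecialFibre X d S h36 Sigma SigmaHat hsub hne hprime hp TpH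
      ((TpH.map (TemperedGraphGroupData.exists_completion_of_prop36 S.Gc h36
        S.chart).choose_spec.choose.toMonoidHom).topologicalClosure) (Subgroup.le_topologicalClosure _) cuspMeetsH).ρHat.ker → a * x = x * a) →
        a ∈ ((OfSpecialFibre.towerOfSpecialFibreTower X d T Sigma SigmaHat hsub hne hprime S h36 hp TpH
        ((TpH.map (TemperedGraphGroupData.exists_completion_of_prop36 S.Gc h36
        S.chart).choose_spec.choose.toMonoidHom).topologicalClosure) (Subgroup.le_topologicalClosure _)
        cuspMeetsH).Jhat i).subgroupOf (ofSpecialFibre X d S h36 Sigma SigmaHat hsub hne hprime hp TpH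
      ((TpH.map (TemperedGraphGroupData.exists_completion_of_prop36 S.Gc h36
        S.chart).choose_spec.choose.toMonoidHom).topologicalClosure) (Subgroup.le_topologicalClosure _) cuspMeetsH).DeltaHat)
    (hB : SigmaHat = {q | q.Prime} →
      ∀ (i : ℕ) (a : (ofSpecialFibre X d S h36 Sigma SigmaHat hsub hne hprime hp TpH
      ((TpH.map (TemperedGraphGroupData.exists_completion_of_prop36 S.Gc h36
        S.chart).choose_spec.choose.toMonoidHom).topologicalClosure) (Subgroup.le_topologicalClosure _) cuspMeetsH).DeltaHat),
        (∀ x ∈ ((OfSpecialFibre.towerOfSpecialFibreTower X d T Sigma SigmaHat hsub hne hprime S h36 hp TpH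
        ((TpH.map (TemperedGraphGroupData.exists_completion_of_prop36 S.Gc h36
        S.chart).choose_spec.choose.toMonoidHom).topologicalClosure) (Subgroup.le_topologicalClosure _)
        cuspMeetsH).Jhat i).subgroupOf (ofSpecialFibre X d S h36 Sigma SigmaHat hsub hne hprime hp TpH
      ((TpH.map (TemperedGraphGroupData.exists_completion_of_prop36 S.Gc h36
        S.chart).choose_spec.choose.toMonoidHom).topologicalClosure) (Subgroup.le_topologicalClosure _) cuspMeetsH).DeltaHat,
          x ∈ (ofSpecialFibre X d S h36 Sigma SigmaHat hsub hne hprime hp TpH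
      ((TpH.map (TemperedGraphGroupData.exists_completion_of_prop36 S.Gc h36
        S.chart).choose_spec.choose.toMonoidHom).topologicalClosure) (Subgroup.le_topologicalClosure _) cuspMeetsH).ρHat.ker → a * x = x * a) →
        a ∈ ((OfSpecialFibre.towerOfSpecialFibreTower X d T Sigma SigmaHat hsub hne hprime S h36 hp TpH
        ((TpH.map (TemperedGraphGroupData.exists_completion_of_prop36 S.Gc h36
        S.chart).choose_spec.choose.toMonoidHom).topologicalClosure) (Subgroup.le_topologicalClosure _)
        cuspMeetsH).Jhat i).subgroupOf (ofSpecialFibre X d S h36 Sigma SigmaHat hsub hne hprime hp TpH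
      ((TpH.map (TemperedGraphGroupData.exists_completion_of_prop36 S.Gc h36
        S.chart).choose_spec.choose.toMonoidHom).topologicalClosure) (Subgroup.le_topologicalClosure _) cuspMeetsH).DeltaHat)
    {H : S.Gc.graph.Subgraph} [Finite S.Gc.graph.Vertex] [Finite S.Gc.graph.Edge] (hcoh : S.Gc.IsCoherent)
    (hTpH : TpH ∈ S.chart.decompSubgroups H) (hconn : (S.Gc.restrict H).IsConnected)
    (hv : (S.Gc.restrict H).HasVertex)
    (hHstab : ∀ g : X.PiTemp, ∃ t : S.chart.G,
      TpH.map (S.autOfConj P.admissibleKer_normal_pi g).toMulEquiv.toMonoidHom = MulAut.conj t • TpH) :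
    ((ofSpecialFibre X d S h36 Sigma SigmaHat hsub hne hprime hp TpH
      ((TpH.map (TemperedGraphGroupData.exists_completion_of_prop36 S.Gc h36
        S.chart).choose_spec.choose.toMonoidHom).topologicalClosure) (Subgroup.le_topologicalClosure _) cuspMeetsH).Cor23i ∧
      (ofSpecialFibre X d S h36 Sigma SigmaHat hsub hne hprime hp TpH
      ((TpH.map (TemperedGraphGroupData.exists_completion_of_prop36 S.Gc h36
        S.chart).choose_spec.choose.toMonoidHom).topologicalClosure) (Subgroup.le_topologicalClosure _) cuspMeetsH).Cor23ii ∧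
      (ofSpecialFibre X d S h36 Sigma SigmaHat hsub hne hprime hp TpH
      ((TpH.map (TemperedGraphGroupData.exists_completion_of_prop36 S.Gc h36
        S.chart).choose_spec.choose.toMonoidHom).topologicalClosure) (Subgroup.le_topologicalClosure _) cuspMeetsH).Cor23iii ∧
      (ofSpecialFibre X d S h36 Sigma SigmaHat hsub hne hprime hp TpH
      ((TpH.map (TemperedGraphGroupData.exists_completion_of_prop36 S.Gc h36
        S.chart).choose_spec.choose.toMonoidHom).topologicalClosure) (Subgroup.le_topologicalClosure _) cuspMeetsH).Cor23iv) ∧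
      (ofSpecialFibre X d S h36 Sigma SigmaHat hsub hne hprime hp TpH
      ((TpH.map (TemperedGraphGroupData.exists_completion_of_prop36 S.Gc h36
        S.chart).choose_spec.choose.toMonoidHom).topologicalClosure) (Subgroup.le_topologicalClosure _) cuspMeetsH).Cor23v :=
  haveI : Finite H.toSemiGraph.Vertex := inferInstanceAs (Finite H.verts)
  haveI : Finite H.toSemiGraph.Edge := inferInstanceAs (Finite H.edges)
  ⟨cor23_i_to_iv_ofSpecialFibre_closureH_of_piData_of_mem_decompSubgroups X d S h36 Sigma SigmaHat hsub hne hprime hp TpH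
      cuspMeetsH T P hA hB hTpH hconn hv hHstab,
    cor23v_ofSpecialFibre_closureH_of_mem_decompSubgroups X d S h36 Sigma SigmaHat hsub hne hprime hp TpH cuspMeetsH hcoh
      hTpH hconn hv⟩

end Block

end StableCurveTemperedData

end Literature.IUT.HodgeTheaters

end
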